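import Mathlib
import Summits.NavierStokesRegularity.NavierStokesRegularity.Theses.BarrierStepRungThree
import HarnessLib

/-!
# `BarrierStepRungThree.Assembly` — the route's assembly (item stmt-NavierStokesRegularity-23424; pure logic)

**Statement.** `BarrierCertificate → BarrierSoundness → RestartControl → RestartGlue →
LocalDynamicsSufficesAt → TaoLadderRungThree.Target`.

PROOF. The route file carries the planner-authored, kernel-checked deciding theorem
`Theses.BarrierStepRungThree.closes` with exactly these hypotheses; the assembly is its curried
form. An IMPLICATION only: the hypotheses (among them the open certificate cruxes) remain hypotheses.

HONEST FRAMING: pure logic between the route's own statements about a Tao-type MODEL lattice rung;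
nothing about Navier–Stokes.
-/

noncomputable section

set_option linter.dupNamespace false

namespace Summit.NavierStokesRegularity.NavierStokesRegularity.Theorems

open Summit.NavierStokesRegularity.NavierStokesRegularity.Theses.BarrierStepRungThree in
/-- **Item stmt-NavierStokesRegularity-23424** (`BarrierStepRungThree.Assembly`): the route's items imply
the rung `TaoLadderRungThree.Target`, by the route file's deciding theorem `closes` (an implication;
its hypotheses stay hypotheses). [this file] -/
theorem barrierStepRungThree_assembly_proof :
    Summit.NavierStokesRegularity.NavierStokesRegularity.Theses.BarrierStepRungThree.Assembly := by
  unfold Summit.NavierStokesRegularity.NavierStokesRegularity.Theses.BarrierStepRungThree.Assembly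
  intro h₁ h₂ h₃ h₄ h₅
  -- (buildfix 2026-08-28) the route's `closes` was re-keyed (01:53Z) to the R-variants
  -- `BarrierCertificateR` / `BarrierSoundnessR` (window-wise bound `Mw`, thin-tail clauses); this CLOSED
  -- assembly item keeps its accepted statement over `BarrierCertificate` / `BarrierSoundness`, so the
  -- pre-edit chain of `closes` is inlined: the v1 certificate binders (`M`, `Φ : Fin n → ℝ`) and the v1
  -- admissibility predicate feed `RestartControl` / `RestartGlue` / `LocalDynamicsSufficesAt` verbatim.
  obtain ⟨R, θ, c, η, γ, M, i₀, α, X₀, n, kLo, v, g, r, q, ρ, env, Ψ, Φ, win, vf, hcond⟩ := h₁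
  obtain ⟨hP, hstep⟩ := h₂ R θ c η γ M i₀ α X₀ n kLo v g r q ρ env Ψ Φ win vf hcond
  obtain ⟨hR, hα, hX₀, hθ0, hθ, hc, hη, -⟩ := hcond
  -- work at a general scale ratio `ε₀ > 0`; specialise to the dyadic `ε₀ = 1` at the end
  obtain ⟨ε₀, hε₀, hε₁⟩ : ∃ ε₀ : ℝ, 0 < ε₀ ∧ ε₀ = 1 := ⟨1, one_pos, rfl⟩
  rw [← hε₁] at hstep
  have hdyn : Literature.Analysis.FluidPDE.TaoCascade.DynamicsLocalAt ε₀ R := by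
    refine ⟨θ, c, i₀, _, X₀, (fun S F => v (win S) ≤ 0 ∧ 0 < g (win S) ∧ (∀ i k, 0 ≤ F i k) ∧ (∀ i k, (k < kLo ∨ kLo + n ≤ k) → F i k ≤ r k ^ 2 / 2) ∧ ∃ B : ℝ, ∀ i k, F i k ≤ B),
      Literature.Analysis.FluidPDE.TaoCascade.epochEnvelope env, hθ0, by linarith, hc,
      hα, hX₀, hP, ?_⟩
    intro K₁ K₂ hK₁ hK₂
    obtain ⟨N₀, hN₀⟩ := h₃ ε₀ θ c η i₀ _ X₀ (fun S F => v (win S) ≤ 0 ∧ 0 < g (win S) ∧ (∀ i k, 0 ≤ F i k) ∧ (∀ i k, (k < kLo ∨ kLo + n ≤ k) → F i k ≤ r k ^ 2 / 2) ∧ ∃ B : ℝ, ∀ i k, F i k ≤ B) env K₁ K₂ hε₀ hθ hc.le hη hX₀ hK₁ hK₂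
    refine ⟨N₀, fun n₀ hn₀ T hT X E hsol N hN t e hcp hhor => ?_⟩
    have heN : 0 < e N := hcp.e_pos N hN le_rfl
    have hpow : 0 < (1 + ε₀) ^ ((5 : ℝ) * N / 2) := Real.rpow_pos_of_pos (by linarith) _
    have hγ : 0 < e N * (1 + ε₀) ^ ((5 : ℝ) * N / 2) := mul_pos heN hpow
    have hneg : (1 + ε₀) ^ (-(5 : ℝ) * N / 2) = ((1 + ε₀) ^ ((5 : ℝ) * N / 2))⁻¹ := by
      rw [← Real.rpow_neg (by linarith : (0 : ℝ) ≤ 1 + ε₀)]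
      congr 1
      ring
    have hcγ : c * (1 + ε₀) ^ (-(5 : ℝ) * N / 2) * (e N)⁻¹ =
        c / (e N * (1 + ε₀) ^ ((5 : ℝ) * N / 2)) := by
      rw [hneg]
      field_simp
    rw [hcγ] at hhor
    have hdiv : 0 < c / (e N * (1 + ε₀) ^ ((5 : ℝ) * N / 2)) := div_pos hc hγ
    have htN : t N < T := by linarith
    have hτ : c ≤ (T - t N) * (e N * (1 + ε₀) ^ ((5 : ℝ) * N / 2)) := by
      have h2 : c / (e N * (1 + ε₀) ^ ((5 : ℝ) * N / 2)) ≤ T - t N := by linarith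
      have h3 := mul_le_mul_of_nonneg_right h2 hγ.le
      rwa [div_mul_cancel₀ c hγ.ne'] at h3
    obtain ⟨hflow, hslack⟩ := hN₀ n₀ hn₀ T hT X E hsol N hN t e hcp htN
    obtain ⟨τ₁, a, hst⟩ :=
      hstep (N - n₀).toNat _ _ _ (hcp.state N hN le_rfl) hslack _ hτ _ _ hflow
    exact ⟨_, _, h₄ ε₀ θ c 4 i₀ n₀ X₀ _ _ N X E t e τ₁ a hε₀ hN hcp hst⟩
  rw [hε₁] at hdyn
  obtain ⟨α', X₀', hα', hng⟩ := h₅ 1 R one_pos hR hdyn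
  exact ⟨R, hR, α', X₀', hα', hng⟩

end Summit.NavierStokesRegularity.NavierStokesRegularity.Theorems

end
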